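/-
Copyright (c) 2026. All rights reserved.
Released under Apache 2.0 license as described in the file LICENSE.
Authors: abc-iut cell, seat abc-iut-w6-d102 (gen 2).
-/
import Mathlib.GroupTheory.Nilpotent
import Mathlib.GroupTheory.SpecificGroups.Cyclic
import Mathlib.Data.SetLike.Fintype
import Mathlib.Topology.Algebra.OpenSubgroup
import Literature.GroupTheory.ProPPowerMap
import HarnessLib

/-!
# Strong completeness by solvable descent

A topological group is *strongly complete* when every subgroup of finite index is open (spelled out;
no definition is introduced).  This PROOF-ONLY file records the elementary DESCENT step reducing
strong completeness of a group all of whose abstract finite quotients are SOLVABLE to the openness of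
normal subgroups of PRIME index of its open subgroups — the skeleton of Serre's theorem for pro-`p`
groups (Dixon–du Sautoy–Mann–Segal, *Analytic pro-`p` groups*, proof of Thm 1.17), of Hartley's for
poly-pronilpotent and of Segal's for prosoluble groups:

* `exists_normal_index_prime_of_isSolvable` — a finite solvable nontrivial group has a normal subgroup
  of prime index;
* `isOpen_of_finiteIndex_of_primeIndex_descent` — for ANY topological group `G`: if (H1) for every
  OPEN subgroup `U` every subgroup `M ≤ U`, normal in `U` and of prime index in `U`, is open, and (H2)
  `G ⧸ N` is solvable for every normal finite-index subgroup `N`, then every finite-index subgroup of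
  `G` is open (strong induction on the index through open subgroups; no compactness is used);
* `isSolvable_quotient_of_normal_series` / `isSolvable_quotient_of_proP_series` — (H2) from a normal
  series `P ≤ I ≤ G` with `G ⧸ I`, `I ⧸ P` abelian and `P` with solvable abstract finite quotients,
  e.g. `P` a closed pro-`p` subgroup of a profinite group (`isPGroup_quotient_of_finiteIndex_of_proP`);
* `primeIndex_isOpen_of_primeCharacter` / `isOpen_of_finiteIndex_of_primeCharacter` — (H1) from:
  every abstract character `U →* Multiplicative (ZMod ℓ)`, `ℓ` prime, `U` open, has open kernel.  The
  companion file `StronglyCompleteSolvableDescentCommutator` derives (H1) instead from CLOSED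
  commutator subgroups of the open subgroups of a topologically finitely generated profinite group.

Intended use (abc-iut, GAP row G-L3d2g2-1 / F-1977 at the absolute Galois group `Γ_K` of a `p`-adic
local field, shape `P_K ≤ I_K ≤ Γ_K`): the last, abstract step of «every finite-index subgroup of `Γ_K`
is open»; the group-theoretic inputs are NOT proved here.  Nothing here bears on [IUTchIII] Cor. 3.12.

[cite: DDMSAnalyticProP1999, Thm 1.17] [cite: Rotman1995, Ch. 5]
-/

namespace Literature.GroupTheory

namespace StronglyCompleteSolvableDescent

open Topology
open scoped commutatorElement

universe u

/-! ## 1. Finite solvable groups have normal subgroups of prime index -/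

section Algebra

variable {Q : Type u} [Group Q]

/-- A subgroup containing the commutator subgroup is normal. [folklore] -/
private theorem normal_of_commutator_le {M : Subgroup Q} (hM : commutator Q ≤ M) : M.Normal := by
  refine ⟨fun m hm g => ?_⟩
  have hc : ⁅g, m⁆ ∈ M := hM (Subgroup.commutator_mem_commutator (Subgroup.mem_top g)
    (Subgroup.mem_top m))
  have : ⁅g, m⁆ * m = g * m * g⁻¹ := by rw [commutatorElement_def]; group
  rw [← this]
  exact M.mul_mem hc hm

/-- **A finite solvable nontrivial group has a normal subgroup of prime index**: a maximal proper
subgroup `M` containing the commutator subgroup is normal with `Q ⧸ M` simple and commutative, hence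
cyclic of prime order — the first step of a normal series with factors cyclic of prime order (Rotman's
definition of solvability for finite groups, equivalent to `G⁽ⁿ⁾ = 1` by his Thm 5.23).
[cite: Rotman1995, Ch. 5 Definition p. 98 and Thm 5.23] -/
theorem exists_normal_index_prime_of_isSolvable [Finite Q] [IsSolvable Q] [Nontrivial Q] :
    ∃ M : Subgroup Q, M.Normal ∧ M.index.Prime := by
  classical
  -- maximal proper subgroup above the commutator subgroup
  set S : Set (Subgroup Q) := {M | commutator Q ≤ M ∧ M ≠ ⊤} with hS
  have hSne : S.Nonempty :=
    ⟨commutator Q, le_rfl, (IsSolvable.commutator_lt_top_of_nontrivial (G := Q)).ne⟩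
  obtain ⟨M, ⟨hCM, hMtop⟩, hmax⟩ := (Set.toFinite S).exists_maximal hSne
  haveI hMn : M.Normal := normal_of_commutator_le hCM
  refine ⟨M, hMn, ?_⟩
  haveI : IsMulCommutative (Q ⧸ M) := by
    refine ⟨⟨fun a b => ?_⟩⟩
    induction a using QuotientGroup.induction_on with
    | H x =>
      induction b using QuotientGroup.induction_on with
      | H y =>
        rw [← QuotientGroup.mk_mul, ← QuotientGroup.mk_mul, QuotientGroup.eq]
        have h : ⁅y⁻¹, x⁻¹⁆ ∈ M := hCM (Subgroup.commutator_mem_commutator (Subgroup.mem_top _)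
          (Subgroup.mem_top _))
        simpa [commutatorElement_def, mul_assoc] using h
  haveI : Nontrivial (Q ⧸ M) := by
    rw [← Finite.one_lt_card_iff_nontrivial, ← Subgroup.index]
    exact Subgroup.one_lt_index_of_ne_top hMtop
  have hsimple : IsSimpleGroup (Q ⧸ M) := by
    refine IsSimpleGroup.mk fun H _ => ?_
    set K : Subgroup Q := H.comap (QuotientGroup.mk' M) with hK
    have hMK : M ≤ K := by
      intro x hx
      rw [hK, Subgroup.mem_comap, QuotientGroup.mk'_apply, (QuotientGroup.eq_one_iff x).mpr hx]
      exact H.one_mem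
    have hHK : H = K.map (QuotientGroup.mk' M) :=
      (Subgroup.map_comap_eq_self_of_surjective (QuotientGroup.mk'_surjective M) H).symm
    by_cases hKtop : K = ⊤
    · right
      rw [hHK, hKtop, ← MonoidHom.range_eq_map, MonoidHom.range_eq_top.mpr
        (QuotientGroup.mk'_surjective M)]
    · left
      have hKS : K ∈ S := ⟨hCM.trans hMK, hKtop⟩
      have hKM : K = M := le_antisymm (hmax hKS hMK) hMK
      rw [hHK, hKM, (Subgroup.map_eq_bot_iff _).mpr (by rw [QuotientGroup.ker_mk'])]
  exact (Group.is_simple_iff_prime_card.mp hsimple)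

end Algebra

/-! ## 2. The descent -/

section Descent

variable {G : Type u} [Group G] [TopologicalSpace G]

/-- Transport of openness from an open subgroup: if `U` is open in `G` and `M ≤ U` is open as a subset
of `↥U`, then `M` is open in `G`. [folklore] -/
private theorem isOpen_of_isOpen_subgroupOf {U M : Subgroup G} (hU : IsOpen (U : Set G)) (hMU : M ≤ U)
    (hM : IsOpen ((M.subgroupOf U : Subgroup U) : Set U)) : IsOpen (M : Set G) := by
  have himg : IsOpen (((↑) : U → G) '' ((M.subgroupOf U : Subgroup U) : Set U)) :=
    hU.isOpenMap_subtype_val _ hM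
  have hset : ((↑) : U → G) '' ((M.subgroupOf U : Subgroup U) : Set U) = (M : Set G) := by
    ext x
    constructor
    · rintro ⟨y, hy, rfl⟩
      exact Subgroup.mem_subgroupOf.mp hy
    · intro hx
      exact ⟨⟨x, hMU hx⟩, Subgroup.mem_subgroupOf.mpr hx, rfl⟩
  rw [hset] at himg
  exact himg

omit [TopologicalSpace G] in
/-- Solvability of `U ⧸ N` (for `N ≤ U` normal in `U`, of finite index in `G`) from the solvability of
the finite quotients `G ⧸ N'` by normal finite-index subgroups `N'` of `G` (take `N'` the normal core of
`N`: `U ⧸ (N' ∩ U)` embeds in `G ⧸ N'` and maps onto `U ⧸ N`). [folklore] -/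
private theorem isSolvable_quotient_subgroupOf
    (hsolv : ∀ (N : Subgroup G) [N.Normal] [N.FiniteIndex], IsSolvable (G ⧸ N))
    (U N : Subgroup G) [hNU : (N.subgroupOf U).Normal] [N.FiniteIndex] :
    IsSolvable (U ⧸ N.subgroupOf U) := by
  set N₀ : Subgroup G := N.normalCore with hN₀
  haveI : N₀.FiniteIndex := Subgroup.finiteIndex_normalCore N
  haveI : IsSolvable (G ⧸ N₀) := hsolv N₀
  set φ : U →* G ⧸ N₀ := (QuotientGroup.mk' N₀).comp U.subtype with hφ
  have hker : φ.ker = N₀.subgroupOf U := by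
    rw [hφ, ← MonoidHom.comap_ker, QuotientGroup.ker_mk']
    rfl
  haveI : IsSolvable (U ⧸ φ.ker) :=
    solvable_of_solvable_injective (QuotientGroup.kerLift_injective φ)
  have hle : φ.ker ≤ N.subgroupOf U := by
    rw [hker]
    exact fun x hx => Subgroup.mem_subgroupOf.mpr (Subgroup.normalCore_le N
      (Subgroup.mem_subgroupOf.mp hx))
  haveI : φ.ker.Normal := inferInstance
  exact solvable_of_surjective
    (QuotientGroup.map_surjective_of_surjective φ.ker (N.subgroupOf U) (MonoidHom.id U)
      (by exact QuotientGroup.mk_surjective) (by simpa using hle))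

/-- **Strong completeness by solvable descent.** Let `G` be a topological group such that
(H1) for every OPEN subgroup `U` of `G`, every subgroup `M ≤ U` which is normal in `U` and of PRIME
index in `U` is open; (H2) for every normal subgroup `N` of finite index, the (abstract) quotient
`G ⧸ N` is solvable.  Then every subgroup of finite index of `G` is open.  Proof: for `N` normal in an
open `U` of index `n > 1`, `U ⧸ N` is finite solvable nontrivial, so has a normal subgroup `M ⧸ N` of
prime index; `M` is open by (H1) and `[M : N] < n`; strong induction; a general finite-index `H`
contains its normal core.  This is the skeleton of the proof of Serre's theorem for finitely generated
pro-`p` groups in Dixon–du Sautoy–Mann–Segal (where (H1) is «`G^p[G,G] = Φ(G)` is open» and (H2) is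
«finite quotients of pro-`p` groups are `p`-groups»), with `p`-groups replaced by solvable groups.
[cite: DDMSAnalyticProP1999, Thm 1.17 (proof)] -/
theorem isOpen_of_finiteIndex_of_primeIndex_descent [ContinuousMul G]
    (hprime : ∀ U M : Subgroup G, IsOpen (U : Set G) → M ≤ U → (M.subgroupOf U).Normal →
      (M.relIndex U).Prime → IsOpen (M : Set G))
    (hsolv : ∀ (N : Subgroup G) [N.Normal] [N.FiniteIndex], IsSolvable (G ⧸ N))
    (H : Subgroup G) [H.FiniteIndex] : IsOpen (H : Set G) := by
  classical
  -- the inductive statement, on the index `[U : N]`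
  have key : ∀ (n : ℕ) (U N : Subgroup G), IsOpen (U : Set G) → N ≤ U → (N.subgroupOf U).Normal →
      N.FiniteIndex → N.relIndex U = n → IsOpen (N : Set G) := by
    intro n
    induction n using Nat.strong_induction_on with
    | _ n ih =>
      intro U N hU hNU hNn hNfi hn
      have hn0 : N.relIndex U ≠ 0 := by
        intro h0
        have hdvd := Subgroup.relIndex_dvd_index_of_le hNU
        rw [h0, zero_dvd_iff] at hdvd
        exact hNfi.index_ne_zero hdvd
      by_cases hn1 : N.relIndex U = 1
      · -- `N = U`
        have hUN : U ≤ N := Subgroup.relIndex_eq_one.mp hn1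
        rw [le_antisymm hNU hUN]
        exact hU
      -- `U ⧸ N` is finite, solvable, nontrivial
      haveI hfiU : (N.subgroupOf U).FiniteIndex := ⟨hn0⟩
      haveI : Finite (U ⧸ N.subgroupOf U) := Subgroup.finite_quotient_of_finiteIndex
      haveI : IsSolvable (U ⧸ N.subgroupOf U) := isSolvable_quotient_subgroupOf hsolv U N
      haveI : Nontrivial (U ⧸ N.subgroupOf U) := by
        rw [← Finite.one_lt_card_iff_nontrivial, ← Subgroup.index]
        change 1 < N.relIndex U
        omega
      -- a normal subgroup `Mq` of prime index of `U ⧸ N`; pull it back to `M ≤ U`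
      obtain ⟨Mq, hMqn, hMqp⟩ :=
        exists_normal_index_prime_of_isSolvable (Q := U ⧸ N.subgroupOf U)
      set π : U →* U ⧸ N.subgroupOf U := QuotientGroup.mk' (N.subgroupOf U) with hπ
      set M' : Subgroup U := Mq.comap π with hM'
      haveI hM'n : M'.Normal := Subgroup.Normal.comap hMqn π
      set M : Subgroup G := M'.map U.subtype with hM
      have hMU : M ≤ U := Subgroup.map_subtype_le M'
      have hMsub : M.subgroupOf U = M' := by
        rw [hM, Subgroup.subgroupOf, Subgroup.comap_map_eq_self_of_injective U.subtype_injective]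
      have hNM' : N.subgroupOf U ≤ M' := by
        intro x hx
        rw [hM', Subgroup.mem_comap, hπ, QuotientGroup.mk'_apply,
          (QuotientGroup.eq_one_iff x).mpr hx]
        exact Mq.one_mem
      have hNM : N ≤ M := by
        intro x hx
        have hx' : (⟨x, hNU hx⟩ : U) ∈ M' := hNM' (Subgroup.mem_subgroupOf.mpr hx)
        exact ⟨⟨x, hNU hx⟩, hx', rfl⟩
      have hMidx : M.relIndex U = Mq.index := by
        rw [Subgroup.relIndex, hMsub, hM',
          Subgroup.index_comap_of_surjective Mq (QuotientGroup.mk'_surjective _)]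
      have hMn : (M.subgroupOf U).Normal := by rw [hMsub]; exact hM'n
      have hMopen : IsOpen (M : Set G) := hprime U M hU hMU hMn (hMidx ▸ hMqp)
      -- `N` is normal in `M` with smaller index: induction
      have hNMn : (N.subgroupOf M).Normal := by
        rw [Subgroup.normal_subgroupOf_iff hNM]
        intro h k hh hk
        exact (Subgroup.normal_subgroupOf_iff hNU).mp hNn h k hh (hMU hk)
      have hlt : N.relIndex M < n := by
        have hmul := Subgroup.relIndex_mul_relIndex N M U hNM hMU
        rw [hn, hMidx] at hmul
        have h2 : 2 ≤ Mq.index := hMqp.two_le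
        have hpos : 0 < N.relIndex M := by
          rcases Nat.eq_zero_or_pos (N.relIndex M) with h0 | h0
          · rw [h0, zero_mul] at hmul; omega
          · exact h0
        nlinarith
      exact ih _ hlt M N hMopen hNM hNMn hNfi rfl
  -- apply to the normal core of `H` inside `U = ⊤`
  set N₀ : Subgroup G := H.normalCore with hN₀
  haveI : N₀.FiniteIndex := Subgroup.finiteIndex_normalCore H
  have hN₀n : (N₀.subgroupOf ⊤).Normal := by
    rw [Subgroup.normal_subgroupOf_iff le_top]
    intro h k hh _
    exact (inferInstance : N₀.Normal).conj_mem h hh k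
  have hN₀open : IsOpen (N₀ : Set G) :=
    key _ ⊤ N₀ (by rw [Subgroup.coe_top]; exact isOpen_univ) le_top hN₀n inferInstance rfl
  exact Subgroup.isOpen_mono (Subgroup.normalCore_le H) hN₀open

end Descent

/-! ## 3. Solvability of the abstract finite quotients -/

section Solvable

variable {G : Type u} [Group G]

/-- **(H2) from a normal series with abelian top factors.** Let `P ≤ I` be normal subgroups of `G`
with all commutators of `G` in `I` and all commutators of `I` in `P` (so `G ⧸ I` and `I ⧸ P` are
abelian), and suppose every abstract finite-index normal quotient of `P` is solvable (e.g. `P`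
pro-`p`).  Then `G ⧸ N` is solvable for every normal finite-index subgroup `N` of `G`: the image of
`P` in `G ⧸ N` is a quotient of `P ⧸ (N ∩ P)`, and `G ⧸ (N ⊔ P)` is metabelian (extensions of
solvable groups by solvable groups are solvable). [cite: Rotman1995, Thm 5.17] -/
theorem isSolvable_quotient_of_normal_series (P I : Subgroup G) [P.Normal] [I.Normal]
    (hGI : ∀ x y : G, x * y * x⁻¹ * y⁻¹ ∈ I) (hIP : ∀ x ∈ I, ∀ y ∈ I, x * y * x⁻¹ * y⁻¹ ∈ P)
    (hP : ∀ (M : Subgroup P) [M.Normal] [M.FiniteIndex], IsSolvable (P ⧸ M))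
    (N : Subgroup G) [N.Normal] [N.FiniteIndex] : IsSolvable (G ⧸ N) := by
  classical
  -- the `P`-part: `P ⧸ (N ∩ P)` is solvable and maps onto the image of `P` in `G ⧸ N`
  haveI : (N.subgroupOf P).Normal := inferInstance
  haveI : (N.subgroupOf P).FiniteIndex := by
    refine ⟨?_⟩
    change N.relIndex P ≠ 0
    intro h0
    exact (inferInstance : N.FiniteIndex).index_ne_zero
      (Subgroup.index_eq_zero_of_relIndex_eq_zero h0)
  haveI hPsolv : IsSolvable (P ⧸ N.subgroupOf P) := hP _
  -- the top part: `G ⧸ (N ⊔ P)` is metabelian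
  haveI : (N ⊔ P).Normal := inferInstance
  have hD2 : derivedSeries G 2 ≤ P := by
    have h1 : derivedSeries G 1 ≤ I := by
      rw [derivedSeries_succ, derivedSeries_zero, Subgroup.commutator_le]
      intro x _ y _
      rw [commutatorElement_def]
      exact hGI x y
    rw [derivedSeries_succ, Subgroup.commutator_le]
    intro x hx y hy
    rw [commutatorElement_def]
    exact hIP x (h1 hx) y (h1 hy)
  haveI hTop : IsSolvable (G ⧸ (N ⊔ P)) := by
    refine ⟨⟨2, ?_⟩⟩
    rw [← map_derivedSeries_eq (QuotientGroup.mk'_surjective (N ⊔ P)), Subgroup.map_eq_bot_iff,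
      QuotientGroup.ker_mk']
    exact hD2.trans le_sup_right
  -- glue along `P ⧸ (N ∩ P) → G ⧸ N → G ⧸ (N ⊔ P)`
  set f : P ⧸ N.subgroupOf P →* G ⧸ N :=
    QuotientGroup.map (N.subgroupOf P) N P.subtype (fun x hx => Subgroup.mem_subgroupOf.mp hx)
    with hf
  set g : G ⧸ N →* G ⧸ (N ⊔ P) := QuotientGroup.map N (N ⊔ P) (MonoidHom.id G)
    (by simp) with hg
  refine solvable_of_ker_le_range f g ?_
  intro z hz
  induction z using QuotientGroup.induction_on with
  | H x =>
    have hx : x ∈ N ⊔ P := by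
      rw [hg, MonoidHom.mem_ker, QuotientGroup.map_mk, MonoidHom.id_apply,
        QuotientGroup.eq_one_iff] at hz
      exact hz
    have hx' : x ∈ ((N ⊔ P : Subgroup G) : Set G) := hx
    rw [Subgroup.normal_mul] at hx'
    obtain ⟨n, hn, q, hq, rfl⟩ := Set.mem_mul.mp hx'
    refine ⟨QuotientGroup.mk ⟨q, hq⟩, ?_⟩
    rw [hf, QuotientGroup.map_mk, Subgroup.subtype_apply, QuotientGroup.eq]
    simpa [mul_assoc] using (inferInstance : N.Normal).conj_mem n hn q⁻¹

end Solvable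

section ProP

variable {G : Type u} [Group G] [TopologicalSpace G] [IsTopologicalGroup G] [CompactSpace G]
  [TotallyDisconnectedSpace G]

/-- **(H2) for a profinite group with a closed normal pro-`p` subgroup `P ≤ I` and abelian factors
`G ⧸ I`, `I ⧸ P`** (the shape wild inertia ≤ inertia ≤ absolute Galois group of a `p`-adic local
field): every abstract finite quotient `G ⧸ N` is solvable — abstract finite quotients of the pro-`p`
group `P` are `p`-groups (`isPGroup_quotient_of_finiteIndex_of_proP`, Serre), hence nilpotent.
[cite: DDMSAnalyticProP1999, Lemma 1.18] -/
theorem isSolvable_quotient_of_proP_series {p : ℕ} [Fact p.Prime] (P I : Subgroup G) [P.Normal]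
    [I.Normal] (hPc : IsClosed (P : Set G))
    (hPp : ∀ U : OpenNormalSubgroup P, IsPGroup p (P ⧸ (U : Subgroup P)))
    (hGI : ∀ x y : G, x * y * x⁻¹ * y⁻¹ ∈ I) (hIP : ∀ x ∈ I, ∀ y ∈ I, x * y * x⁻¹ * y⁻¹ ∈ P)
    (N : Subgroup G) [N.Normal] [N.FiniteIndex] : IsSolvable (G ⧸ N) := by
  haveI : CompactSpace P := isCompact_iff_compactSpace.mp hPc.isCompact
  refine isSolvable_quotient_of_normal_series P I hGI hIP (fun M _ _ => ?_) N
  haveI : Finite (P ⧸ M) := Subgroup.finite_quotient_of_finiteIndex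
  have hpg : IsPGroup p (P ⧸ M) := isPGroup_quotient_of_finiteIndex_of_proP hPp M
  haveI : Group.IsNilpotent (P ⧸ M) := hpg.isNilpotent
  infer_instance

end ProP

/-! ## 4. (H1) from continuity of prime-order characters -/

section Character

variable {G : Type u} [Group G] [TopologicalSpace G]

/-- **(H1) from prime-order characters.** If for every open subgroup `U` of `G` and every prime `ℓ`
every (abstract) homomorphism `χ : U →* Multiplicative (ZMod ℓ)` has open kernel, then every subgroup
`M ≤ U` normal in `U` of prime index `ℓ` is open: `U ⧸ M` is cyclic of order `ℓ`, i.e. isomorphic to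
`Multiplicative (ZMod ℓ)`, and `M` is the kernel of the resulting character (the step «a normal
subgroup of index `p` is open» of Serre's theorem). [cite: DDMSAnalyticProP1999, Thm 1.17 (proof)] -/
theorem primeIndex_isOpen_of_primeCharacter
    (hχ : ∀ U : Subgroup G, IsOpen (U : Set G) → ∀ ℓ : ℕ, ℓ.Prime →
      ∀ χ : U →* Multiplicative (ZMod ℓ), IsOpen ((χ.ker : Subgroup U) : Set U))
    (U M : Subgroup G) (hU : IsOpen (U : Set G)) (hMU : M ≤ U) (hMn : (M.subgroupOf U).Normal)
    (hMp : (M.relIndex U).Prime) : IsOpen (M : Set G) := by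
  classical
  haveI := hMn
  haveI : Fact (M.relIndex U).Prime := ⟨hMp⟩
  haveI : (M.subgroupOf U).FiniteIndex := ⟨hMp.ne_zero⟩
  haveI : Finite (U ⧸ M.subgroupOf U) := Subgroup.finite_quotient_of_finiteIndex
  have hcard : Nat.card (U ⧸ M.subgroupOf U) = M.relIndex U := by rw [← Subgroup.index]; rfl
  have hcyc : IsCyclic (U ⧸ M.subgroupOf U) := isCyclic_of_prime_card (p := M.relIndex U) hcard
  -- the character `U → U ⧸ M ≃ Multiplicative (ZMod ℓ)`
  set e : Multiplicative (ZMod (Nat.card (U ⧸ M.subgroupOf U))) ≃* U ⧸ M.subgroupOf U :=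
    zmodCyclicMulEquiv hcyc with he
  set χ : U →* Multiplicative (ZMod (Nat.card (U ⧸ M.subgroupOf U))) :=
    e.symm.toMonoidHom.comp (QuotientGroup.mk' (M.subgroupOf U)) with hχdef
  have hker : χ.ker = M.subgroupOf U := by
    ext x
    rw [MonoidHom.mem_ker, hχdef, MonoidHom.comp_apply, MulEquiv.coe_toMonoidHom,
      MulEquiv.map_eq_one_iff, QuotientGroup.mk'_apply, QuotientGroup.eq_one_iff]
  have hopen : IsOpen ((χ.ker : Subgroup U) : Set U) :=
    hχ U hU _ (hcard ▸ hMp) χ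
  rw [hker] at hopen
  exact isOpen_of_isOpen_subgroupOf hU hMU hopen

/-- **Strong completeness from continuity of prime-order characters and solvable finite quotients.**
If every abstract character of prime order of every open subgroup of the topological group `G` has
open kernel, and every abstract finite normal quotient of `G` is solvable, then every finite-index
subgroup of `G` is open. [cite: DDMSAnalyticProP1999, Thm 1.17 (proof)] -/
theorem isOpen_of_finiteIndex_of_primeCharacter [ContinuousMul G]
    (hχ : ∀ U : Subgroup G, IsOpen (U : Set G) → ∀ ℓ : ℕ, ℓ.Prime →
      ∀ χ : U →* Multiplicative (ZMod ℓ), IsOpen ((χ.ker : Subgroup U) : Set U))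
    (hsolv : ∀ (N : Subgroup G) [N.Normal] [N.FiniteIndex], IsSolvable (G ⧸ N))
    (H : Subgroup G) [H.FiniteIndex] : IsOpen (H : Set G) :=
  isOpen_of_finiteIndex_of_primeIndex_descent (primeIndex_isOpen_of_primeCharacter hχ) hsolv H

end Character

end StronglyCompleteSolvableDescent

end Literature.GroupTheory
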